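import Literature.NumberTheory.EllipticCurves.ModularParametrizationDegree
import Literature.NumberTheory.EllipticCurves.HeegnerFamilyScalingProofs
import HarnessLib

/-!
# Rescaling a modular parametrisation datum by an integer: the datum type is NOT rigid
# (PROOFS + two definitions — no named fact)

ARM P (cell `bsd-cited`, reader `bsd-cited-r19` g4; D-AUDIT-r19 ADDENDUM-5 §4 / ADDENDUM-6; sequel
to `HeegnerFamilyScalingProofs.lean`, p481261). That file took the rescaled parametrisation datum
`Dt'` (`Dt'.φ = m • Dt.φ`) as an INPUT. Here it is CONSTRUCTED: for a datum
`Dt : ModularParametrizationData W N` and `m ≠ 0`, `Dt.zsmul m` has the same newform, Néron lattice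
and uniformisation, Manin-constant field `m · c` (the field is constrained only by `c Λ_f ⊆ Λ_E` —
"`c` is some nonzero multiple of the Manin constant", module docstring of
`ModularParametrizationDegree.lean`) and modular degree `deg · #E(ℂ)[m]`; its `deg_spec` is PROVED
from `Dt`'s (`φ` is constant on `Γ₀(N)`-orbits, `ModularParametrizationData.φ_eq_of_mk_eq_mk_holds'`;
the orbit-fibre of `P` under `m • φ` is the disjoint union of the orbit-fibres of `φ` over the
`#E(ℂ)[m]` points `R` with `m R = P`; `E(ℂ)[m]` is finite and `[m]` is onto, both read off the
uniformisation `ℂ/Λ_E ≅ E(ℂ)` with `Λ_E = ℤω₁ ⊕ ℤω₂`). Consequences, by name: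

* `ModularParametrizationData.φ_zsmul`: `(Dt.zsmul m hm).φ = m • Dt.φ`; `deg_zsmul`.
* `ModularParametrizationData.IsMinimal` (DEFINITION: minimal modular degree among all data for
  `W` at level `N` — the pin proposed as fix F1 in D-AUDIT-r19 ADDENDUM-5 §4.5; for `E/ℚ`,
  `Hom(J₀(N), E) = ℤ·φ_min`, so this singles out `±φ_min`), `exists_isMinimal`, and
  `not_isMinimal_zsmul`: for `|m| ≥ 2` the rescaled datum is NOT minimal (`#E(ℂ)[m] ≥ 2`:
  `ω₁/m ∉ Λ_E`, Mathlib `PeriodPair.mul_ω₁_add_mul_ω₂_mem_lattice`) — i.e. the pin excludes exactly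
  the rescalings that break the integral Heegner-point-main-conjecture layout.
* `HeegnerFamily.zsmulSelf F m hm := F.zsmul (F.Dt.zsmul m hm) m _` and the INPUT-FREE forms of the
  two kernel refutations of p481261: `KellerYin2024.false_of_thm521_OPEN_of_witness`,
  `Castella2024.false_of_thm13_OPEN_of_witness` — the typed `∀ (F : HeegnerFamily …)` integral
  equality (KY arXiv:2402.12781v2 Thm 5.2.1 binder; Castella arXiv:2409.01360 Thm 1.3 binder) yields
  `False` from: the binder, its hypothesis bundle at a non-split multiplicative `p`, data `D`, `X`, ONE
  Heegner family `F` with a torsion-free `Λ`-adic Heegner class `z` and `𝔖/Λz` torsion. Print (one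
  fixed parametrisation: Cas24 l.268, CGS25 l.452–455) is not refuted; the layout is.

HONEST FRAMING: bookkeeping only; 0 named facts; `#print axioms` standard.

## References
* [EdixhovenManin1991] §1 (Manin constant; `c Λ_f ⊆ Λ_E`); [ZagierCMB1985] §1, [CremonaAlgorithms1997]
  §2.10 (modular degree, optimal parametrisation); [SilvermanAEC2009] VI.5.1 (`ℂ/Λ ≅ E(ℂ)`, torsion);
  [KellerYin2024] arXiv:2402.12781v2 Thm 5.2.1; [Castella2024] arXiv:2409.01360 l.268, Thm 1.3;
  [CastellaGrossiLeeSkinner2022] Intro, Remark after Conj. A (TeX L281–283).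
-/

set_option autoImplicit false

noncomputable section

open scoped Classical

open WeierstrassCurve UpperHalfPlane Literature.NumberTheory.EllipticCurves
  Literature.NumberTheory.EllipticCurves.ModularForms
  Literature.NumberTheory.EllipticCurves.Castella2024
  Literature.NumberTheory.EllipticCurves.KellerYin2024

universe u

namespace Literature.NumberTheory.EllipticCurves.ModularForms

/-! ## §1 Orbit-fibre counts of `m • g` -/

section FiberCount

variable {N : ℕ} {A : Type*} [AddCommGroup A]

/-- **Orbit-fibres of `m • g`**: if `g : ℍ → A` is constant on `Γ₀(N)`-orbits, the set of orbits
`y ∈ Y₀(N)` carrying a `τ` with `m • g τ = P` is the disjoint union, over the (finitely many) `R`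
with `m • R = P`, of the orbit-fibres of `g` over `R`; if these all have `d > 0` elements the count
is `#{R | m R = P} · d` (fibres of the composite `[m] ∘ φ` of finite maps).
[cite: DiamondShurman2005, §3.1 (degree of a nonconstant map of compact Riemann surfaces; fibres of a composite)] -/
theorem natCard_fiberOrbits_zsmul (g : ℍ → A)
    (hg : ∀ τ τ' : ℍ, Y0.mk N τ = Y0.mk N τ' → g τ = g τ') (m : ℤ) (P : A) {d : ℕ} (hd : 0 < d)
    [hI : Finite {R : A // m • R = P}]
    (hfib : ∀ R : A, m • R = P → Nat.card {y : Y0 N // ∃ τ : ℍ, Y0.mk N τ = y ∧ g τ = R} = d) :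
    Nat.card {y : Y0 N // ∃ τ : ℍ, Y0.mk N τ = y ∧ m • g τ = P} =
      Nat.card {R : A // m • R = P} * d := by
  classical
  -- the descended map `Y₀(N) → A`
  let gb : Y0 N → A := fun y ↦ g (Classical.choose (Y0.mk_surjective N y))
  have hgb : ∀ τ, gb (Y0.mk N τ) = g τ := fun τ ↦
    hg _ _ (Classical.choose_spec (Y0.mk_surjective N (Y0.mk N τ)))
  have hiff : ∀ (R : A) (y : Y0 N), (∃ τ : ℍ, Y0.mk N τ = y ∧ g τ = R) ↔ gb y = R := by
    intro R y
    constructor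
    · rintro ⟨τ, rfl, rfl⟩
      exact hgb τ
    · intro h
      obtain ⟨τ, rfl⟩ := Y0.mk_surjective N y
      exact ⟨τ, rfl, (hgb τ).symm.trans h⟩
  have hiffm : ∀ y : Y0 N, (∃ τ : ℍ, Y0.mk N τ = y ∧ m • g τ = P) ↔ m • gb y = P := by
    intro y
    constructor
    · rintro ⟨τ, rfl, h⟩
      rw [hgb]
      exact h
    · intro h
      obtain ⟨τ, rfl⟩ := Y0.mk_surjective N y
      exact ⟨τ, rfl, by rw [← hgb]; exact h⟩
  have hfib' : ∀ R : {R : A // m • R = P}, Nat.card {y : Y0 N // gb y = R.1} = d := fun R ↦ by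
    rw [← hfib R.1 R.2]
    exact Nat.card_congr (Equiv.subtypeEquivRight fun y ↦ (hiff R.1 y).symm)
  haveI : Fintype {R : A // m • R = P} := Fintype.ofFinite _
  haveI : ∀ R : {R : A // m • R = P}, Finite {y : Y0 N // gb y = R.1} := fun R ↦
    Nat.finite_of_card_ne_zero (by rw [hfib' R]; exact hd.ne')
  calc Nat.card {y : Y0 N // ∃ τ : ℍ, Y0.mk N τ = y ∧ m • g τ = P}
      = Nat.card {y : Y0 N // m • gb y = P} := Nat.card_congr (Equiv.subtypeEquivRight hiffm)
    _ = Nat.card (Σ R : {R : A // m • R = P}, {y : Y0 N // gb y = R.1}) :=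
        (Nat.card_congr (Equiv.sigmaSubtypeFiberEquivSubtype gb
          (p := fun y ↦ m • gb y = P) (q := fun R ↦ m • R = P) fun _ ↦ Iff.rfl)).symm
    _ = ∑ R : {R : A // m • R = P}, Nat.card {y : Y0 N // gb y = R.1} := Nat.card_sigma
    _ = ∑ _R : {R : A // m • R = P}, d := Finset.sum_congr rfl fun R _ ↦ hfib' R
    _ = Nat.card {R : A // m • R = P} * d := by
        rw [Finset.sum_const, smul_eq_mul, Finset.card_univ, Nat.card_eq_fintype_card]

end FiberCount

/-! ## §2 Torsion and divisibility of `E(ℂ)` through the uniformisation -/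

namespace ModularParametrizationData

section Scaling

variable {W : WeierstrassCurve ℚ} {N : ℕ} [NeZero N] (Dt : ModularParametrizationData W N)

include Dt

/-- `m • uniformize (z / m) = uniformize z` (`uniformize` is additive). [cite: SilvermanAEC2009, Prop. VI.3.6(b) (the uniformisation is a homomorphism)] -/
theorem zsmul_uniformize_div {m : ℤ} (hm : m ≠ 0) (z : ℂ) :
    m • Dt.uniformize (z / m) = Dt.uniformize z := by
  rw [← map_zsmul, zsmul_eq_mul, mul_div_cancel₀ z (Int.cast_ne_zero.mpr hm)]

/-- **`E(ℂ)` is divisible**: `[m]` is onto for `m ≠ 0` (through `ℂ → E(ℂ)`). [cite: SilvermanAEC2009, Thm. VI.5.1 (ℂ/Λ ≅ E(ℂ))] -/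
theorem exists_zsmul_eq {m : ℤ} (hm : m ≠ 0) (P : (W.baseChange ℂ).toAffine.Point) :
    ∃ R : (W.baseChange ℂ).toAffine.Point, m • R = P := by
  obtain ⟨z, rfl⟩ := Dt.uniformize_surjective P
  exact ⟨Dt.uniformize (z / m), Dt.zsmul_uniformize_div hm z⟩

/-- **`E(ℂ)[m]` is finite** for `m ≠ 0`: every `m`-torsion point is `uniformize ((i ω₁ + j ω₂)/m)` with
`0 ≤ i, j < |m|` (`ker uniformize = ℤω₁ + ℤω₂`). [cite: SilvermanAEC2009, Thm. VI.5.1 and Cor. III.6.4 (E[m] over ℂ)] -/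
theorem finite_torsionBy {m : ℤ} (hm : m ≠ 0) :
    Finite {R : (W.baseChange ℂ).toAffine.Point // m • R = 0} := by
  let n : ℕ := m.natAbs
  let gij : Fin n × Fin n → (W.baseChange ℂ).toAffine.Point := fun ij ↦
    Dt.uniformize ((((ij.1 : ℕ) : ℂ) * Dt.L.ω₁ + ((ij.2 : ℕ) : ℂ) * Dt.L.ω₂) / m)
  have hmem : ∀ ij, m • gij ij = 0 := by
    intro ij
    simp only [gij]
    rw [Dt.zsmul_uniformize_div hm, uniformize_eq_zero_iff]
    exact PeriodPair.mem_lattice.mpr ⟨(ij.1 : ℕ), (ij.2 : ℕ), by push_cast; rfl⟩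
  refine Finite.of_surjective
    (fun ij ↦ (⟨gij ij, hmem ij⟩ : {R : (W.baseChange ℂ).toAffine.Point // m • R = 0})) ?_
  rintro ⟨R, hR⟩
  obtain ⟨z, rfl⟩ := Dt.uniformize_surjective R
  have hmz : (m : ℂ) * z ∈ Dt.L.lattice := by
    rw [← Dt.uniformize_eq_zero_iff, ← zsmul_eq_mul, map_zsmul]
    exact hR
  obtain ⟨a, b, hab⟩ := PeriodPair.mem_lattice.mp hmz
  have ha0 : 0 ≤ a % m := Int.emod_nonneg a hm
  have hb0 : 0 ≤ b % m := Int.emod_nonneg b hm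
  have hlt : ∀ x : ℤ, (x % m).toNat < n := fun x ↦ by
    rw [Int.toNat_lt (Int.emod_nonneg x hm)]
    exact Int.emod_lt x hm
  refine ⟨(⟨(a % m).toNat, hlt a⟩, ⟨(b % m).toNat, hlt b⟩), Subtype.ext ?_⟩
  change Dt.uniformize _ = Dt.uniformize z
  rw [eq_comm, ← sub_eq_zero, ← map_sub, uniformize_eq_zero_iff]
  have hi : (((a % m).toNat : ℕ) : ℂ) = ((a % m : ℤ) : ℂ) := by
    rw [← Int.cast_natCast, Int.toNat_of_nonneg ha0]
  have hj : (((b % m).toNat : ℕ) : ℂ) = ((b % m : ℤ) : ℂ) := by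
    rw [← Int.cast_natCast, Int.toNat_of_nonneg hb0]
  simp only [hi, hj]
  have hmC : (m : ℂ) ≠ 0 := Int.cast_ne_zero.mpr hm
  have hz : z = ((a : ℂ) * Dt.L.ω₁ + (b : ℂ) * Dt.L.ω₂) / m := by
    rw [hab, mul_div_cancel_left₀ z hmC]
  refine PeriodPair.mem_lattice.mpr ⟨a / m, b / m, ?_⟩
  have hq1 : ((a % m : ℤ) : ℂ) = (a : ℂ) - (m : ℂ) * ((a / m : ℤ) : ℂ) := by
    rw [Int.emod_def]; push_cast; ring
  have hq2 : ((b % m : ℤ) : ℂ) = (b : ℂ) - (m : ℂ) * ((b / m : ℤ) : ℂ) := by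
    rw [Int.emod_def]; push_cast; ring
  rw [hz, hq1, hq2]
  field_simp
  ring

/-- `E(ℂ)[m]` is non-empty and finite, so its cardinality is positive. [cite: SilvermanAEC2009, Cor. III.6.4] -/
theorem natCard_torsionBy_pos {m : ℤ} (hm : m ≠ 0) :
    0 < Nat.card {R : (W.baseChange ℂ).toAffine.Point // m • R = 0} := by
  haveI := Dt.finite_torsionBy hm
  haveI : Nonempty {R : (W.baseChange ℂ).toAffine.Point // m • R = 0} := ⟨⟨0, zsmul_zero m⟩⟩
  exact Nat.card_pos

/-- **`#E(ℂ)[m] ≥ 2` for `|m| ≥ 2`**: `uniformize (ω₁/m)` is a non-zero `m`-torsion point, since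
`ω₁/m ∉ ℤω₁ + ℤω₂` (Mathlib `PeriodPair.mul_ω₁_add_mul_ω₂_mem_lattice`). [cite: SilvermanAEC2009, Cor. III.6.4] -/
theorem two_le_natCard_torsionBy {m : ℤ} (hm : m ≠ 0) (h2 : 2 ≤ m.natAbs) :
    2 ≤ Nat.card {R : (W.baseChange ℂ).toAffine.Point // m • R = 0} := by
  haveI := Dt.finite_torsionBy hm
  haveI : Fintype {R : (W.baseChange ℂ).toAffine.Point // m • R = 0} := Fintype.ofFinite _
  have hmem : m • Dt.uniformize (Dt.L.ω₁ / m) = 0 := by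
    rw [Dt.zsmul_uniformize_div hm, uniformize_eq_zero_iff]
    exact Dt.L.ω₁_mem_lattice
  have hne : Dt.uniformize (Dt.L.ω₁ / m) ≠ 0 := by
    rw [Ne, uniformize_eq_zero_iff]
    intro hmemL
    have h' : (((m : ℚ)⁻¹ : ℚ) : ℂ) * Dt.L.ω₁ + ((0 : ℚ) : ℂ) * Dt.L.ω₂ ∈ Dt.L.lattice := by
      have : (((m : ℚ)⁻¹ : ℚ) : ℂ) * Dt.L.ω₁ + ((0 : ℚ) : ℂ) * Dt.L.ω₂ = Dt.L.ω₁ / m := by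
        push_cast; ring
      rw [this]; exact hmemL
    have hden := (PeriodPair.mul_ω₁_add_mul_ω₂_mem_lattice.mp h').1
    rw [Rat.inv_intCast_den, if_neg hm] at hden
    omega
  rw [Nat.card_eq_fintype_card]
  exact Fintype.one_lt_card_iff_nontrivial.mpr ⟨⟨⟨0, zsmul_zero m⟩, ⟨_, hmem⟩,
    fun h ↦ hne (congrArg Subtype.val h).symm⟩⟩

/-! ## §3 The rescaled datum `Dt.zsmul m` -/

/-- The parametrisation map of the datum with Manin-constant field `m · c` is `m • φ`.
[cite: EdixhovenManin1991, §1 (φ(τ) = uniformize (c · 2πi ∫ f))] -/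
theorem uniformize_mul_smul_eq (m : ℤ) (τ : ℍ) :
    Dt.uniformize (((m * Dt.c : ℤ) : ℂ) * eichlerIntegral Dt.f τ) = m • Dt.φ τ := by
  rw [ModularParametrizationData.φ, ← map_zsmul, zsmul_eq_mul, Int.cast_mul, mul_assoc]

/-- **The rescaled parametrisation datum** `[m] ∘ φ`: same newform, Néron lattice and
uniformisation; Manin-constant field `m · c` (admissible: `(m c) Λ_f ⊆ Λ_E`); modular degree
`deg · #E(ℂ)[m]`, with `deg_spec` PROVED from `Dt.deg_spec` (`natCard_fiberOrbits_zsmul`,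
`φ_eq_of_mk_eq_mk_holds'`, `finite_torsionBy`, `exists_zsmul_eq`). Witness that
`ModularParametrizationData` does not pin the parametrisation. [cite: EdixhovenManin1991, §1 (c Λ_f ⊆ Λ_E; every multiple of an admissible c is admissible)] -/
def zsmul (m : ℤ) (hm : m ≠ 0) : ModularParametrizationData W N where
  f := Dt.f
  isNewformOf := Dt.isNewformOf
  L := Dt.L
  isNeronLattice := Dt.isNeronLattice
  uniformize := Dt.uniformize
  ker_uniformize := Dt.ker_uniformize
  uniformize_surjective := Dt.uniformize_surjective
  uniformize_spec := Dt.uniformize_spec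
  c := m * Dt.c
  smul_periodLattice_le := fun z hz ↦ by
    rw [Int.cast_mul, mul_assoc, ← zsmul_eq_mul]
    exact zsmul_mem (Dt.smul_periodLattice_le z hz) m
  deg := Dt.deg * Nat.card {R : (W.baseChange ℂ).toAffine.Point // m • R = 0}
  deg_pos := Nat.mul_pos Dt.deg_pos (Dt.natCard_torsionBy_pos hm)
  deg_spec := by
    simp only [Dt.uniformize_mul_smul_eq m]
    refine (Dt.deg_spec.image fun R ↦ m • R).subset ?_
    intro P hP
    by_contra hPimg
    apply hP
    -- every `R` over `P` is non-exceptional for `Dt`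
    have hfib : ∀ R : (W.baseChange ℂ).toAffine.Point, m • R = P →
        Nat.card {y : Y0 N // ∃ τ : ℍ, Y0.mk N τ = y ∧ Dt.φ τ = R} = Dt.deg := by
      intro R hR
      by_contra hne
      exact hPimg ⟨R, hne, hR⟩
    -- `{R | m R = P}` is a translate of `E(ℂ)[m]`
    obtain ⟨R₀, hR₀⟩ := Dt.exists_zsmul_eq hm P
    let e : {R : (W.baseChange ℂ).toAffine.Point // m • R = P} ≃
        {R : (W.baseChange ℂ).toAffine.Point // m • R = 0} :=
      { toFun := fun R ↦ ⟨R.1 - R₀, by rw [zsmul_sub, R.2, hR₀, sub_self]⟩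
        invFun := fun T ↦ ⟨T.1 + R₀, by rw [zsmul_add, T.2, hR₀, zero_add]⟩
        left_inv := fun R ↦ by simp
        right_inv := fun T ↦ by simp }
    haveI := Dt.finite_torsionBy hm
    haveI : Finite {R : (W.baseChange ℂ).toAffine.Point // m • R = P} :=
      Finite.of_equiv _ e.symm
    rw [natCard_fiberOrbits_zsmul (fun τ ↦ Dt.φ τ) (fun τ τ' h ↦ Dt.φ_eq_of_mk_eq_mk_holds' h) m P
      Dt.deg_pos hfib, Nat.card_congr e, mul_comm]

/-- The parametrisation of the rescaled datum is `m • φ`. [cite: EdixhovenManin1991, §1] -/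
theorem φ_zsmul {m : ℤ} (hm : m ≠ 0) (τ : ℍ) : (Dt.zsmul m hm).φ τ = m • Dt.φ τ :=
  Dt.uniformize_mul_smul_eq m τ

/-- The modular degree of the rescaled datum is `deg · #E(ℂ)[m]` (so `m² · deg`). [cite: ZagierCMB1985, §1 (deg([m] ∘ φ) = m² deg φ)] -/
theorem deg_zsmul {m : ℤ} (hm : m ≠ 0) :
    (Dt.zsmul m hm).deg = Dt.deg * Nat.card {R : (W.baseChange ℂ).toAffine.Point // m • R = 0} :=
  rfl

end Scaling

/-! ## §4 Minimal parametrisation data (the pin of fix F1) -/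

section Minimal

variable {W : WeierstrassCurve ℚ} {N : ℕ} [NeZero N]

/-- **A parametrisation datum of MINIMAL modular degree** among all data for `W` at level `N`
("the modular parametrisation of minimal degree", Zagier 1985 §1; Cremona §2.10: for `E/ℚ`,
`Hom(J₀(N), E) = ℤ · φ_min` and `deg([m] ∘ φ_min) = m² deg φ_min`, so this pins `φ` up to sign —
the "given / fixed modular parametrization" of Castella 2024 l.268 and Castella–Grossi–Skinner 2025
l.452–455 read as the optimal one). D-AUDIT-r19 ADDENDUM-5 §4.5, fix F1.
[cite: ZagierCMB1985, §1] [cite: CremonaAlgorithms1997, §2.10] -/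
def IsMinimal (Dt : ModularParametrizationData W N) : Prop :=
  ∀ Dt' : ModularParametrizationData W N, Dt.deg ≤ Dt'.deg

/-- Minimal data exist as soon as data exist (well-ordering of `ℕ`): "the modular parametrisation
of minimal degree". [cite: ZagierCMB1985, §1] -/
theorem exists_isMinimal [h : Nonempty (ModularParametrizationData W N)] :
    ∃ Dt : ModularParametrizationData W N, Dt.IsMinimal := by
  classical
  obtain ⟨Dt₀⟩ := h
  have hP : ∃ d : ℕ, ∃ Dt : ModularParametrizationData W N, Dt.deg = d := ⟨_, Dt₀, rfl⟩
  obtain ⟨Dt, hDt⟩ := Nat.find_spec hP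
  exact ⟨Dt, fun Dt' ↦ hDt ▸ Nat.find_min' hP ⟨Dt', rfl⟩⟩

/-- Two minimal data have the same modular degree ("the" modular degree of `E`).
[cite: ZagierCMB1985, §1] [cite: CremonaAlgorithms1997, §2.10] -/
theorem IsMinimal.deg_eq {Dt Dt' : ModularParametrizationData W N} (h : Dt.IsMinimal)
    (h' : Dt'.IsMinimal) : Dt.deg = Dt'.deg :=
  le_antisymm (h Dt') (h' Dt)

/-- **The pin excludes the rescalings**: for `|m| ≥ 2` the rescaled datum `Dt.zsmul m` is not
minimal (its degree is `deg · #E(ℂ)[m] ≥ 2 deg > deg`). [cite: ZagierCMB1985, §1] -/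
theorem not_isMinimal_zsmul (Dt : ModularParametrizationData W N) {m : ℤ} (hm : m ≠ 0)
    (h2 : 2 ≤ m.natAbs) : ¬ (Dt.zsmul m hm).IsMinimal := by
  intro h
  have hle := h Dt
  rw [deg_zsmul] at hle
  have h2' := Dt.two_le_natCard_torsionBy hm h2
  have hpos := Dt.deg_pos
  nlinarith

end Minimal

end ModularParametrizationData

end Literature.NumberTheory.EllipticCurves.ModularForms

/-! ## §5 Input-free forms of the kernel refutations of `HeegnerFamilyScalingProofs.lean` -/

namespace Literature.NumberTheory.EllipticCurves

variable {K : Type u} [Field K] [NumberField K] {N : ℕ} [NeZero N] {W : WeierstrassCurve ℚ}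
  {p : ℕ} [Fact p.Prime] {κ : ZpExtension K p} {γ : Field.absoluteGaloisGroup K}
  {jbar : AlgebraicClosure K →+* ℂ}

/-- **The Heegner family rescaled by `[m]` along its own rescaled datum** `F.Dt.zsmul m`.
[cite: Howard2004HeegnerKolyvagin, §3.3 (the family y_K, z_0, z_1, …)] -/
def HeegnerFamily.zsmulSelf (F : HeegnerFamily N W K κ jbar) (m : ℤ) (hm : m ≠ 0) :
    HeegnerFamily N W K κ jbar :=
  F.zsmul (F.Dt.zsmul m hm) m (F.Dt.φ_zsmul hm)

namespace KellerYin2024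

/-- **Keller–Yin Thm 5.2.1 as typed (`∀ F`, integral) refutes itself on one non-degenerate
witness** — input-free form of `false_of_thm521_OPEN_zsmul`: the `[p]`-rescaled datum is now the
constructed `F.Dt.zsmul p`. Hypotheses = the binder, its bundle at a NON-SPLIT multiplicative
Eisenstein `p`, data `D`, `X`, a Heegner family `F` with a torsion-free `Λ`-adic Heegner class `z`
and `𝔖/Λz` torsion (print's "`Λ`-rank one, `𝐳_∞` non-torsion"). Print's one-parametrisation
statement is NOT refuted; the `∀ (F : HeegnerFamily …)` layout is. [claim: KellerYin2024, status: under-review]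
[cite: CastellaGrossiLeeSkinner2022, Remark after Conj. A (Intro; TeX L281–283)] -/
theorem false_of_thm521_OPEN_of_witness
    (h : thm521_multHg_charIdeal_torsion_eq_sq_OPEN N W K p κ γ jbar)
    (hyp : Thm521Hypotheses N W K p κ γ) (hns : ¬ W.HasSplitMultiplicativeReductionAtPrime p)
    (D : (W.baseChange K).LambdaAdicSelmerData κ γ) (X : (W.baseChange K).SelmerDualData κ γ)
    (F : HeegnerFamily N W K κ jbar) {z : D.S} (hz : IsLambdaAdicHeegnerClass D F (-1) z)
    (htors : Module.IsTorsion (IwasawaAlgebra p) (D.S ⧸ Submodule.span (IwasawaAlgebra p) {z}))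
    (hfree : ∀ a : IwasawaAlgebra p, a • z = 0 → a = 0) : False :=
  have hp : (p : ℤ) ≠ 0 := Int.natCast_ne_zero.mpr (Fact.out : p.Prime).ne_zero
  false_of_thm521_OPEN_zsmul h hyp hns D X F (F.Dt.zsmul (p : ℤ) hp) (F.Dt.φ_zsmul hp) hz htors hfree

end KellerYin2024

namespace Castella2024

/-- **Castella Thm 1.3 as typed (`∀ F`, integral) refutes itself on one non-degenerate witness** —
input-free form of `false_of_thm13_OPEN_zsmul`. [claim: Castella2024, status: under-review]
[cite: CastellaGrossiLeeSkinner2022, Remark after Conj. A (Intro; TeX L281–283)] -/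
theorem false_of_thm13_OPEN_of_witness [W.IsGloballyMinimal]
    (h : thm13_charIdeal_torsion_eq_sq_OPEN N W K p κ γ jbar)
    (hyp : Thm13Hypotheses N W K p κ γ) (hns : ¬ W.HasSplitMultiplicativeReductionAtPrime p)
    (D : (W.baseChange K).LambdaAdicSelmerData κ γ) (X : (W.baseChange K).SelmerDualData κ γ)
    (F : HeegnerFamily N W K κ jbar) {z : D.S} (hz : IsLambdaAdicHeegnerClass D F (-1) z)
    (htors : Module.IsTorsion (IwasawaAlgebra p) (D.S ⧸ Submodule.span (IwasawaAlgebra p) {z}))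
    (hfree : ∀ a : IwasawaAlgebra p, a • z = 0 → a = 0) : False :=
  have hp : (p : ℤ) ≠ 0 := Int.natCast_ne_zero.mpr (Fact.out : p.Prime).ne_zero
  false_of_thm13_OPEN_zsmul h hyp hns D X F (F.Dt.zsmul (p : ℤ) hp) (F.Dt.φ_zsmul hp) hz htors hfree

end Castella2024

end Literature.NumberTheory.EllipticCurves

end
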